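import Summits.AtomisticToContinuum.FouriersLaw.Theorems.PhononMeanFreePathCoherentDephasingResponseStatics
import Literature.MathematicalPhysics.KineticTheory.PhaseSpacePoisson

/-!
# `CoherentDephasing` / line `Sketch`: strict absorption — generator algebra at the kicked site

Support file for the registered sub-goal `sa_generatorAlgebra` (K4a) of the `N`-uniform STRICT ABSORPTION theorem of
line `Sketch` of crux `stmt-AtomisticToContinuum-11810` (`PhononMeanFreePath.CoherentDephasing`).

For the `(N+1)`-site pinned anharmonic chain `P = pinnedChain ω₂ lam β γ` (`N ≥ 2`, both baths at temperature `T`,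
kicked site `0`, neighbour `1`; `q₀ = z.1 0`, `q₁ = z.1 1`, `p₀ = z.2 0`, `p₁ = z.2 1`) we compute the first two generator
powers of the kicked momentum `p₀` explicitly:

* `L p₀ = G₁`, `G₁ = -U'(q₀) + V'(q₁ - q₀) - γ p₀ = -(ω₂ q₀ + lam q₀³) + ((q₁ - q₀) + β (q₁ - q₀)³) - γ p₀`;
* `L G₁ = G₂`, `G₂ = -p₀ Φ + p₁ V''(q₁ - q₀) + γ (U'(q₀) - V'(q₁ - q₀)) + γ² p₀` with the local curvature
  `Φ = U''(q₀) + V''(q₁ - q₀) = ω₂ + 3 lam q₀² + 1 + 3 β (q₁ - q₀)²` (the bath Laplacians `T ∂²_{p}` kill `G₁`, which is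
  affine in each momentum);
* `G₁, G₂ ∈ C²` (polynomials in the coordinates).

Elementary coordinate calculus (`partialQ`/`partialP` of the explicit polynomial `G₁` by one-variable `HasDerivAt`), the
closed form `∂_{q_0} H = U'(q₀) - V'(q₁ - q₀)` (`pinnedChain_dPotential_succ`) and `generator_snd`. No definitions.
-/

noncomputable section

open MeasureTheory ProbabilityTheory Filter Topology Set
open scoped NNReal ENNReal

namespace Summit.AtomisticToContinuum.FouriersLaw.Theorems.CoherentDephasing.StrictAbsorption

open Literature.MathematicalPhysics.KineticTheory.HeatConduction
open Literature.MathematicalPhysics.KineticTheory Literature.Probability.Process OscillatorChain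
open Summit.AtomisticToContinuum.FouriersLaw.Theorems.CoherentDephasing.MeanFieldDuhamel

/-- `∂Φ/∂q_0` of the `(N+1)`-site pinned chain (`N ≥ 1`): `U'(q₀) - V'(q₁ - q₀)`, i.e.
`ω₂ q₀ + lam q₀³ - ((q₁ - q₀) + β (q₁ - q₀)³)` (only the bond `(0,1)` touches site `0`). [folklore] -/
theorem genAlg_dPotential_zero (ω₂ lam β γ : ℝ) {N : ℕ} (hN : 1 ≤ N) (q : Fin (N + 1) → ℝ) :
    (pinnedChain ω₂ lam β γ).dPotential (N + 1) 0 q =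
      ω₂ * q 0 + lam * q 0 ^ 3 - ((q ⟨1, by omega⟩ - q 0) + β * (q ⟨1, by omega⟩ - q 0) ^ 3) := by
  rw [pinnedChain_dPotential_succ]
  congr 1
  rw [Finset.sum_eq_single ⟨0, by omega⟩]
  · have h1 : (⟨0, by omega⟩ : Fin N).succ = (⟨1, by omega⟩ : Fin (N + 1)) := Fin.ext (by simp)
    have h2 : (⟨0, by omega⟩ : Fin N).castSucc = (0 : Fin (N + 1)) := Fin.ext (by simp)
    rw [h1, h2]
    simp
  · intro b _ hb
    have hb' : (b : ℕ) ≠ 0 := fun h => hb (Fin.ext h)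
    simp [hb']
  · intro h
    exact absurd (Finset.mem_univ _) h

/-- `∂_{q_i} G₁ = -Φ [i = 0] + V''(q₁ - q₀) [i = 1]` for the explicit polynomial
`G₁ = -(ω₂ q₀ + lam q₀³) + ((q₁ - q₀) + β (q₁ - q₀)³) - γ p₀`, `Φ = ω₂ + 3 lam q₀² + 1 + 3β(q₁ - q₀)²`. [folklore] -/
theorem genAlg_partialQ_G₁ (ω₂ lam β γ : ℝ) {N : ℕ} (hN : 1 ≤ N) (i : Fin (N + 1)) (z : PhaseSpace (N + 1)) :
    partialQ i (fun y : PhaseSpace (N + 1) => (-(ω₂ * y.1 0 + lam * y.1 0 ^ 3) +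
        ((y.1 ⟨1, by omega⟩ - y.1 0) + β * (y.1 ⟨1, by omega⟩ - y.1 0) ^ 3) - γ * y.2 0)) z =
      (if i = 0 then -(ω₂ + 3 * lam * z.1 0 ^ 2 + 1 + 3 * β * (z.1 ⟨1, by omega⟩ - z.1 0) ^ 2) else 0) +
        (if i = ⟨1, by omega⟩ then 1 + 3 * β * (z.1 ⟨1, by omega⟩ - z.1 0) ^ 2 else 0) := by
  have h10 : (⟨1, by omega⟩ : Fin (N + 1)) ≠ 0 := by simp [Fin.ext_iff]
  unfold partialQ
  rcases eq_or_ne i 0 with rfl | hi0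
  · simp only [if_true, if_neg h10.symm, add_zero, Function.update_self, Function.update_of_ne h10]
    have hd : HasDerivAt (fun t : ℝ => -(ω₂ * t + lam * t ^ 3) +
        ((z.1 ⟨1, by omega⟩ - t) + β * (z.1 ⟨1, by omega⟩ - t) ^ 3) - γ * z.2 0)
        (-(ω₂ * 1 + lam * ((3 : ℕ) * z.1 0 ^ (3 - 1) * 1)) +
          ((-1) + β * ((3 : ℕ) * (z.1 ⟨1, by omega⟩ - z.1 0) ^ (3 - 1) * (-1)))) (z.1 0) := by
      have := ((((hasDerivAt_id' (z.1 0)).const_mul ω₂).add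
        (((hasDerivAt_id' (z.1 0)).fun_pow 3).const_mul lam)).neg.add
        (((hasDerivAt_id' (z.1 0)).const_sub (z.1 ⟨1, by omega⟩)).add
          ((((hasDerivAt_id' (z.1 0)).const_sub (z.1 ⟨1, by omega⟩)).fun_pow 3).const_mul β))).sub_const
        (γ * z.2 0)
      exact this
    rw [hd.deriv]
    norm_num
    ring
  · rcases eq_or_ne i ⟨1, by omega⟩ with rfl | hi1
    · simp only [if_neg h10, if_true, zero_add, Function.update_self, Function.update_of_ne h10.symm]
      have hd : HasDerivAt (fun t : ℝ => -(ω₂ * z.1 0 + lam * z.1 0 ^ 3) +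
          ((t - z.1 0) + β * (t - z.1 0) ^ 3) - γ * z.2 0)
          (0 + (1 + β * ((3 : ℕ) * (z.1 ⟨1, by omega⟩ - z.1 0) ^ (3 - 1) * 1)))
          (z.1 ⟨1, by omega⟩) := by
        have := (((hasDerivAt_const (z.1 ⟨1, by omega⟩) (-(ω₂ * z.1 0 + lam * z.1 0 ^ 3))).add
          (((hasDerivAt_id' (z.1 ⟨1, by omega⟩)).sub_const (z.1 0)).add
            ((((hasDerivAt_id' (z.1 ⟨1, by omega⟩)).sub_const (z.1 0)).fun_pow 3).const_mul β)))).sub_const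
          (γ * z.2 0)
        exact this
      rw [hd.deriv]
      norm_num
      ring
    · simp only [if_neg hi0, if_neg hi1, add_zero, Function.update_of_ne (Ne.symm hi0),
        Function.update_of_ne (Ne.symm hi1), deriv_const]

/-- `∂_{p_i} G₁ = -γ [i = 0]` for `G₁ = -(ω₂ q₀ + lam q₀³) + ((q₁ - q₀) + β (q₁ - q₀)³) - γ p₀`. [folklore] -/
theorem genAlg_partialP_G₁ (ω₂ lam β γ : ℝ) {N : ℕ} (hN : 1 ≤ N) (i : Fin (N + 1)) (z : PhaseSpace (N + 1)) :
    partialP i (fun y : PhaseSpace (N + 1) => (-(ω₂ * y.1 0 + lam * y.1 0 ^ 3) +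
        ((y.1 ⟨1, by omega⟩ - y.1 0) + β * (y.1 ⟨1, by omega⟩ - y.1 0) ^ 3) - γ * y.2 0)) z =
      if i = 0 then -γ else 0 := by
  unfold partialP
  rcases eq_or_ne i 0 with rfl | hi0
  · simp only [if_true, Function.update_self]
    have hd : HasDerivAt (fun t : ℝ => -(ω₂ * z.1 0 + lam * z.1 0 ^ 3) +
        ((z.1 ⟨1, by omega⟩ - z.1 0) + β * (z.1 ⟨1, by omega⟩ - z.1 0) ^ 3) - γ * t) (-(γ * 1)) (z.2 0) :=
      ((hasDerivAt_id' (z.2 0)).const_mul γ).const_sub _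
    rw [hd.deriv, mul_one]
  · simp only [if_neg hi0, Function.update_of_ne (Ne.symm hi0), deriv_const]

/-- `∂²_{p_i} G₁ = 0` (`G₁` is affine in each momentum). [folklore] -/
theorem genAlg_partialP_partialP_G₁ (ω₂ lam β γ : ℝ) {N : ℕ} (hN : 1 ≤ N) (i : Fin (N + 1))
    (z : PhaseSpace (N + 1)) :
    partialP i (partialP i (fun y : PhaseSpace (N + 1) => (-(ω₂ * y.1 0 + lam * y.1 0 ^ 3) +
        ((y.1 ⟨1, by omega⟩ - y.1 0) + β * (y.1 ⟨1, by omega⟩ - y.1 0) ^ 3) - γ * y.2 0))) z = 0 := by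
  have h : partialP i (fun y : PhaseSpace (N + 1) => (-(ω₂ * y.1 0 + lam * y.1 0 ^ 3) +
      ((y.1 ⟨1, by omega⟩ - y.1 0) + β * (y.1 ⟨1, by omega⟩ - y.1 0) ^ 3) - γ * y.2 0)) =
      fun _ => if i = 0 then -γ else 0 :=
    funext fun y => genAlg_partialP_G₁ ω₂ lam β γ hN i y
  rw [h, partialP_const]

/-- `G₁ ∈ C²` (a polynomial in `q₀, q₁, p₀`). [folklore] -/
theorem genAlg_contDiff_G₁ (ω₂ lam β γ : ℝ) {N : ℕ} (hN : 1 ≤ N) :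
    ContDiff ℝ 2 (fun y : PhaseSpace (N + 1) => (-(ω₂ * y.1 0 + lam * y.1 0 ^ 3) +
      ((y.1 ⟨1, by omega⟩ - y.1 0) + β * (y.1 ⟨1, by omega⟩ - y.1 0) ^ 3) - γ * y.2 0)) := by
  have hq : ∀ x : Fin (N + 1), ContDiff ℝ 2 (fun y : PhaseSpace (N + 1) => y.1 x) := fun x =>
    (contDiff_apply ℝ ℝ x).comp contDiff_fst
  have hp : ∀ x : Fin (N + 1), ContDiff ℝ 2 (fun y : PhaseSpace (N + 1) => y.2 x) := fun x =>
    (contDiff_apply ℝ ℝ x).comp contDiff_snd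
  exact (((contDiff_const.mul (hq 0)).add (contDiff_const.mul ((hq 0).pow 3))).neg.add
    (((hq _).sub (hq 0)).add (contDiff_const.mul (((hq _).sub (hq 0)).pow 3)))).sub
    (contDiff_const.mul (hp 0))

/-- `G₂ ∈ C²` (a polynomial in `q₀, q₁, p₀, p₁`). [folklore] -/
theorem genAlg_contDiff_G₂ (ω₂ lam β γ : ℝ) {N : ℕ} (hN : 1 ≤ N) :
    ContDiff ℝ 2 (fun y : PhaseSpace (N + 1) =>
      (-(y.2 0 * (ω₂ + 3 * lam * y.1 0 ^ 2 + 1 + 3 * β * (y.1 ⟨1, by omega⟩ - y.1 0) ^ 2)) +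
        y.2 ⟨1, by omega⟩ * (1 + 3 * β * (y.1 ⟨1, by omega⟩ - y.1 0) ^ 2) +
        γ * (ω₂ * y.1 0 + lam * y.1 0 ^ 3 - ((y.1 ⟨1, by omega⟩ - y.1 0) + β * (y.1 ⟨1, by omega⟩ - y.1 0) ^ 3)) +
        γ ^ 2 * y.2 0)) := by
  have hq : ∀ x : Fin (N + 1), ContDiff ℝ 2 (fun y : PhaseSpace (N + 1) => y.1 x) := fun x =>
    (contDiff_apply ℝ ℝ x).comp contDiff_fst
  have hp : ∀ x : Fin (N + 1), ContDiff ℝ 2 (fun y : PhaseSpace (N + 1) => y.2 x) := fun x =>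
    (contDiff_apply ℝ ℝ x).comp contDiff_snd
  have hΦ : ContDiff ℝ 2 (fun y : PhaseSpace (N + 1) =>
      ω₂ + 3 * lam * y.1 0 ^ 2 + 1 + 3 * β * (y.1 ⟨1, by omega⟩ - y.1 0) ^ 2) :=
    ((contDiff_const.add (contDiff_const.mul ((hq 0).pow 2))).add contDiff_const).add
      (contDiff_const.mul (((hq _).sub (hq 0)).pow 2))
  have hW : ContDiff ℝ 2 (fun y : PhaseSpace (N + 1) => 1 + 3 * β * (y.1 ⟨1, by omega⟩ - y.1 0) ^ 2) :=
    contDiff_const.add (contDiff_const.mul (((hq _).sub (hq 0)).pow 2))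
  have hF : ContDiff ℝ 2 (fun y : PhaseSpace (N + 1) =>
      ω₂ * y.1 0 + lam * y.1 0 ^ 3 - ((y.1 ⟨1, by omega⟩ - y.1 0) + β * (y.1 ⟨1, by omega⟩ - y.1 0) ^ 3)) :=
    ((contDiff_const.mul (hq 0)).add (contDiff_const.mul ((hq 0).pow 3))).sub
      (((hq _).sub (hq 0)).add (contDiff_const.mul (((hq _).sub (hq 0)).pow 3)))
  exact ((((hp 0).mul hΦ).neg.add ((hp _).mul hW)).add (contDiff_const.mul hF)).add
    (contDiff_const.mul (hp 0))

/-- **Generator algebra at the kicked site** (sub-goal K4a of the strict-absorption theorem): for the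
`(N+1)`-site pinned chain with both baths at `T` (`N ≥ 2`), `L p₀ = G₁` and `L G₁ = G₂` pointwise with the explicit
polynomials `G₁ = -U'(q₀) + V'(q₁ - q₀) - γ p₀`,
`G₂ = -p₀ Φ + p₁ V''(q₁ - q₀) + γ (U'(q₀) - V'(q₁ - q₀)) + γ² p₀`, `Φ = U''(q₀) + V''(q₁ - q₀)`, and `G₁, G₂ ∈ C²`.
[folklore] -/
theorem sa_generatorAlgebra :
    ∀ ω₂ lam β γ : ℝ, 0 < ω₂ → 0 < lam → 0 < β → 0 < γ → ∀ T : ℝ, 0 < T → ∀ (N : ℕ) (hN : 2 ≤ N), (∀ z : PhaseSpace (N + 1), (pinnedChain ω₂ lam β γ).generator (N + 1) T T (fun y => y.2 0) z = (-(ω₂ * z.1 0 + lam * z.1 0 ^ 3) + ((z.1 ⟨1, by omega⟩ - z.1 0) + β * (z.1 ⟨1, by omega⟩ - z.1 0) ^ 3) - γ * z.2 0)) ∧ (∀ z : PhaseSpace (N + 1), (pinnedChain ω₂ lam β γ).generator (N + 1) T T (fun y : PhaseSpace (N + 1) => (-(ω₂ * y.1 0 + lam * y.1 0 ^ 3) +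 ((y.1 ⟨1, by omega⟩ - y.1 0) + β * (y.1 ⟨1, by omega⟩ - y.1 0) ^ 3) - γ * y.2 0)) z = (-(z.2 0 * (ω₂ + 3 * lam * z.1 0 ^ 2 + 1 + 3 * β * (z.1 ⟨1, by omega⟩ - z.1 0) ^ 2)) + z.2 ⟨1, by omega⟩ * (1 + 3 * β * (z.1 ⟨1, by omega⟩ - z.1 0) ^ 2) + γ * (ω₂ * z.1 0 + lam * z.1 0 ^ 3 - ((z.1 ⟨1, by omega⟩ - z.1 0) + β * (z.1 ⟨1, by omega⟩ - z.1 0) ^ 3)) + γ ^ 2 * z.2 0)) ∧ ContDiff ℝ 2 (fun y : PhaseSpace (N + 1) => (-(ω₂ * y.1 0 + lam * y.1 0 ^ 3) + ((y.1 ⟨1, by omega⟩ - y.1 0) + β * (y.1 ⟨1, by omega⟩ - y.1 0) ^ 3) - γ * y.2 0)) ∧ ContDiff ℝ 2 (fun y : PhaseSpace (N + 1) => (-(y.2 0 * (ω₂ + 3 * lam * y.1 0 ^ 2 + 1 + 3 * β * (y.1 ⟨1, by omega⟩ - y.1 0) ^ 2)) + y.2 ⟨1, by omega⟩ * (1 +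 3 * β * (y.1 ⟨1, by omega⟩ - y.1 0) ^ 2) + γ * (ω₂ * y.1 0 + lam * y.1 0 ^ 3 - ((y.1 ⟨1, by omega⟩ - y.1 0) + β * (y.1 ⟨1, by omega⟩ - y.1 0) ^ 3)) + γ ^ 2 * y.2 0)) := by
  intro ω₂ lam β γ _hω _hl _hβ _hγ T _hT N hN
  have hN1 : 1 ≤ N := by omega
  have hU : Differentiable ℝ (pinnedChain ω₂ lam β γ).U :=
    (pinnedChain_contDiff_U ω₂ lam β γ (n := 1)).differentiable one_ne_zero
  have hV : Differentiable ℝ (pinnedChain ω₂ lam β γ).V :=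
    (pinnedChain_contDiff_V ω₂ lam β γ (n := 1)).differentiable one_ne_zero
  have hγ' : (pinnedChain ω₂ lam β γ).γ = γ := rfl
  have h10 : (⟨1, by omega⟩ : Fin (N + 1)) ≠ 0 := by simp [Fin.ext_iff]
  have h0N : (0 : ℕ) ≠ N + 1 - 1 := by omega
  have hdP : ∀ z : PhaseSpace (N + 1), (pinnedChain ω₂ lam β γ).dPotential (N + 1) 0 z.1 =
      ω₂ * z.1 0 + lam * z.1 0 ^ 3 - ((z.1 ⟨1, by omega⟩ - z.1 0) + β * (z.1 ⟨1, by omega⟩ - z.1 0) ^ 3) :=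
    fun z => genAlg_dPotential_zero ω₂ lam β γ hN1 z.1
  refine ⟨fun z => ?_, fun z => ?_, genAlg_contDiff_G₁ ω₂ lam β γ hN1, genAlg_contDiff_G₂ ω₂ lam β γ hN1⟩
  · -- `L p₀ = -∂_{q₀}H - γ p₀`
    rw [generator_snd (pinnedChain ω₂ lam β γ) hU hV T T 0 z, hdP z, hγ']
    simp only [Fin.val_zero, if_true, if_neg h0N, add_zero]
    ring
  · -- `L G₁ = G₂`
    have hQ := genAlg_partialQ_G₁ ω₂ lam β γ hN1
    have hP := genAlg_partialP_G₁ ω₂ lam β γ hN1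
    have hPP := genAlg_partialP_partialP_G₁ ω₂ lam β γ hN1
    have hH : ∀ i, partialQ i ((pinnedChain ω₂ lam β γ).hamiltonian (N + 1)) z =
        (pinnedChain ω₂ lam β γ).dPotential (N + 1) i z.1 := fun i =>
      (pinnedChain ω₂ lam β γ).partialQ_hamiltonian_eq_dPotential hU hV (N + 1) z i
    unfold OscillatorChain.generator
    simp only [hQ, hP, hPP, hH, hγ']
    -- the Hamiltonian part: only `i = 0` and `i = 1` contribute
    rw [Finset.sum_eq_add (0 : Fin (N + 1)) ⟨1, by omega⟩ h10.symm]
    · -- the bath part: only `i = 0` contributes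
      rw [Finset.sum_eq_single (0 : Fin (N + 1))]
      · simp only [if_true, if_neg h10, if_neg h10.symm, Fin.val_zero, if_neg h0N, hdP z]
        ring
      · intro i _ hi
        simp [hi]
      · intro h
        exact absurd (Finset.mem_univ _) h
    · intro c _ hc
      simp [hc.1, hc.2]
    · intro h
      exact absurd (Finset.mem_univ _) h
    · intro h
      exact absurd (Finset.mem_univ _) h

end Summit.AtomisticToContinuum.FouriersLaw.Theorems.CoherentDephasing.StrictAbsorption

end
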